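import Summits.Ventures.CertifiedManyBodySolver.Upper.TorusRectBlockPartition
import Literature.MathematicalPhysics.QuantumLattice.TorusPlaquetteDictionaryPairFieldLocal
import HarnessLib

/-!
# Cluster trial states for the pinning-field rows, part 2: no wrap-around inside a block, and
# parity bookkeeping on product states over an ordered cluster partition

HONEST FRAMING: first certified bounds; not a superconductivity verdict; every number certified or
labelled float. Nothing in this file is a number: it is finite-torus bookkeeping for cluster trial states.

Companion of `Upper/TorusRectBlockPartition.lean` (seat hubbard-obs-pin-1). Two independent pieces of
bookkeeping used by the block cut and the cluster variational bound of the pair-sourced torus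
(parts 3–4):

* §1 PARITY (any ordered cluster partition `P : ClusterProduct.Partition ι' C κ`, tree
  `ClusterProductStates`): vectors of different fermion parity are orthogonal; parity-reversing /
  parity-preserving operators shift / keep the parity of a vector; an EVEN one-cluster operator has
  expectation `⟨ψ_c, a ψ_c⟩` in a product of unit factors (`star_prodFamily_dotProduct_jwEmbed_eq`); TWO
  parity-REVERSING one-cluster operators on DIFFERENT clusters — an inter-cluster hopping `c†c`, an
  inter-cluster pair `cc` or `c†c†` — have ZERO expectation in a product of definite-parity factors
  (`star_prodFamily_dotProduct_jwEmbed_jwEmbed_eq_zero` and its three specialisations): the factor of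
  the second cluster ends up with the opposite parity (tree: `jwEmbed_mulVec_prodFamily_of_parityReversing`).
* §2 NO WRAP-AROUND (`a, b < L`): the torus step relation restricted to one block of the `a × b` block
  partition is the box step relation (`toTorusSite_blockSite_eq_add_proj_iff`), hence torus adjacency
  of two sites of one block is open-box adjacency (`fermionTorusGraph_adj_blockSite_iff`, the
  hypothesis `hG` of the tree's block cut `sourced_sub_sum_jwEmbed_sub_onSiteSum_eq`).

References: O. Bratteli, D. W. Robinson, *Operator Algebras and QSM II* (1997) §5.2.2, eq. (5.2.13)
(graded product states; Jordan–Wigner strings through lower clusters); D. Ruelle, *Statistical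
Mechanics* (1969) §3.3 (sub-boxes). Tree: `ClusterProductStates`, `TwoClusterFock`, `torusGraph_adj_iff`,
`TorusPlaquette.isParityPreserving_annihilation_mul_annihilation` (`TorusPlaquetteDictionaryPairFieldLocal`).
-/

noncomputable section

namespace Summit.Ventures.CertifiedManyBodySolver

open Matrix Finset Literature.Probability.LatticeModels
open Literature.MathematicalPhysics.QuantumLattice Literature.MathematicalPhysics.QuantumLattice.ThermodynamicLimit
open Literature.MathematicalPhysics.QuantumLattice.TwoCluster Literature.MathematicalPhysics.QuantumLattice.ClusterProduct

/-! ## §1 Parity bookkeeping -/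

namespace ClusterParity

/-- Vectors of different fermion parity are orthogonal. [folklore] -/
theorem dotProduct_eq_zero_of_hasParity_of_ne {κ : Type*} [Fintype κ] {p q : ℕ} {v w : Fock κ}
    (hv : HasParity p v) (hw : HasParity q w) (h : p % 2 ≠ q % 2) : star v ⬝ᵥ w = 0 := by
  rw [dotProduct]
  refine Finset.sum_eq_zero fun s _ => ?_
  by_cases hs : v s = 0
  · rw [Pi.star_apply, hs, star_zero, zero_mul]
  · by_cases ht : w s = 0
    · rw [ht, mul_zero]
    · exact absurd ((hv s hs).symm.trans (hw s ht)) h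

/-- Scalar multiples keep the parity. [folklore] -/
theorem hasParity_smul {κ : Type*} {p : ℕ} {v : Fock κ} (hv : HasParity p v) (c : ℂ) : HasParity p (c • v) :=
  fun s hs => hv s (by rw [Pi.smul_apply, smul_eq_mul] at hs; exact right_ne_zero_of_mul hs)

/-- The parity operator keeps the parity. [folklore] -/
theorem hasParity_parityOp_mulVec {κ : Type*} [LinearOrder κ] [Fintype κ] {p : ℕ} {v : Fock κ}
    (hv : HasParity p v) : HasParity p (TwoCluster.parityOp *ᵥ v) :=
  fun s hs => hv s (by rw [parityOp_mulVec_apply] at hs; exact right_ne_zero_of_mul hs)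

/-- A parity-reversing operator flips the parity of a vector. [folklore] -/
theorem hasParity_mulVec_of_isParityReversing {κ : Type*} [Fintype κ] {x : Matrix (Finset κ) (Finset κ) ℂ}
    (hx : IsParityReversing x) {p : ℕ} {v : Fock κ} (hv : HasParity p v) : HasParity (p + 1) (x *ᵥ v) := by
  intro s hs
  simp only [Matrix.mulVec, dotProduct] at hs
  obtain ⟨t, -, ht⟩ := Finset.exists_ne_zero_of_sum_ne_zero hs
  have h1 := hx s t (left_ne_zero_of_mul ht)
  have h2 := hv t (right_ne_zero_of_mul ht)
  omega

/-- An even operator keeps the parity of a vector. [folklore] -/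
theorem hasParity_mulVec_of_isParityPreserving {κ : Type*} [Fintype κ] {x : Matrix (Finset κ) (Finset κ) ℂ}
    (hx : IsParityPreserving x) {p : ℕ} {v : Fock κ} (hv : HasParity p v) : HasParity p (x *ᵥ v) := by
  intro s hs
  simp only [Matrix.mulVec, dotProduct] at hs
  obtain ⟨t, -, ht⟩ := Finset.exists_ne_zero_of_sum_ne_zero hs
  have h1 := hx s t (left_ne_zero_of_mul ht)
  have h2 := hv t (right_ne_zero_of_mul ht)
  omega

/-- The adjoint of an even operator is even. [folklore] -/
theorem isParityPreserving_conjTranspose {κ : Type*} {x : Matrix (Finset κ) (Finset κ) ℂ} (hx : IsParityPreserving x) :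
    IsParityPreserving xᴴ := by
  intro s t h
  rw [conjTranspose_apply, ne_eq, star_eq_zero] at h
  exact (hx t s h).symm

/-- A difference of even operators is even. [folklore] -/
theorem isParityPreserving_sub {κ : Type*} {x y : Matrix (Finset κ) (Finset κ) ℂ} (hx : IsParityPreserving x)
    (hy : IsParityPreserving y) : IsParityPreserving (x - y) := by
  rw [sub_eq_add_neg]
  exact hx.add hy.neg


/-! ### Product states over an ordered cluster partition -/

variable {ι' C κ : Type*} [LinearOrder ι'] [LinearOrder C] [LinearOrder κ] (P : Partition ι' C κ)
  [Fintype ι'] [Fintype C] [Fintype κ]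

/-- **An even one-cluster operator has expectation `⟨ψ_{c₀}, a ψ_{c₀}⟩`** in a product of unit factors.
[cite: BratteliRobinsonII1997, §5.2.2] -/
theorem star_prodFamily_dotProduct_jwEmbed_eq [DecidableEq C] {a : Matrix (Finset κ) (Finset κ) ℂ}
    (ha : IsParityPreserving a) (c₀ : C) {ψ : C → Fock κ} (hψ : ∀ c, star (ψ c) ⬝ᵥ ψ c = 1) :
    star (P.prodFamily ψ) ⬝ᵥ (jwEmbed (P.emb c₀) a *ᵥ P.prodFamily ψ) = star (ψ c₀) ⬝ᵥ (a *ᵥ ψ c₀) := by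
  rw [P.jwEmbed_mulVec_prodFamily ha, P.star_prodFamily_dotProduct_prodFamily]
  rw [Finset.prod_eq_single c₀ (fun c _ hc => by rw [Function.update_of_ne hc, hψ]) (fun h => absurd (Finset.mem_univ _) h),
    Function.update_self]

/-- **Two parity-reversing one-cluster operators on different clusters have zero expectation** in a
product of factors of definite parity: the factor of the second cluster ends up with the opposite
parity. [cite: BratteliRobinsonII1997, §5.2.2 eq. (5.2.13)] -/
theorem star_prodFamily_dotProduct_jwEmbed_jwEmbed_eq_zero [DecidableEq C] {ψ : C → Fock κ} {p : C → ℕ}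
    (hψ : ∀ c, HasParity (p c) (ψ c)) {c₁ c₂ : C} (hne : c₁ ≠ c₂)
    {x₁ x₂ : Matrix (Finset κ) (Finset κ) ℂ} (hx₁ : IsParityReversing x₁) (hx₂ : IsParityReversing x₂) :
    star (P.prodFamily ψ) ⬝ᵥ (jwEmbed (P.emb c₁) x₁ *ᵥ (jwEmbed (P.emb c₂) x₂ *ᵥ P.prodFamily ψ)) = 0 := by
  rw [P.jwEmbed_mulVec_prodFamily_of_parityReversing hx₂ c₂ ψ,
    P.jwEmbed_mulVec_prodFamily_of_parityReversing hx₁ c₁ _, P.star_prodFamily_dotProduct_prodFamily]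
  apply Finset.prod_eq_zero (Finset.mem_univ c₂)
  -- the factor at `c₂` has parity `p c₂ + 1`
  have hodd : HasParity (p c₂ + 1) (x₂ *ᵥ ψ c₂) := hasParity_mulVec_of_isParityReversing hx₂ (hψ c₂)
  have hne' : c₂ ≠ c₁ := fun h => hne h.symm
  by_cases hlt : c₂ < c₁
  · simp only [if_pos hlt, lt_irrefl, if_false, Function.update_self]
    exact dotProduct_eq_zero_of_hasParity_of_ne (hψ c₂) (hasParity_parityOp_mulVec hodd) (by omega)
  · simp only [if_neg hlt, Function.update_of_ne hne', lt_irrefl, if_false, Function.update_self]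
    exact dotProduct_eq_zero_of_hasParity_of_ne (hψ c₂) hodd (by omega)

/-- `c†_{emb c₁ i} c_{emb c₂ j}` (inter-cluster hopping, `c₁ ≠ c₂`) has zero expectation.
[cite: BratteliRobinsonII1997, §5.2.2 eq. (5.2.13)] -/
theorem star_prodFamily_dotProduct_creation_annihilation_eq_zero [DecidableEq C] {ψ : C → Fock κ} {p : C → ℕ}
    (hψ : ∀ c, HasParity (p c) (ψ c)) {c₁ c₂ : C} (hne : c₁ ≠ c₂) (i j : κ) :
    star (P.prodFamily ψ) ⬝ᵥ ((creation (P.emb c₁ i) * annihilation (P.emb c₂ j)) *ᵥ P.prodFamily ψ) = 0 := by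
  rw [← mulVec_mulVec, ← jwEmbed_creation, ← jwEmbed_annihilation]
  exact star_prodFamily_dotProduct_jwEmbed_jwEmbed_eq_zero P hψ hne (Partition.isParityReversing_creation i)
    (Partition.isParityReversing_annihilation j)

/-- `c_{emb c₁ i} c_{emb c₂ j}` (inter-cluster pair, `c₁ ≠ c₂`) has zero expectation.
[cite: BratteliRobinsonII1997, §5.2.2 eq. (5.2.13)] -/
theorem star_prodFamily_dotProduct_annihilation_annihilation_eq_zero [DecidableEq C] {ψ : C → Fock κ} {p : C → ℕ}
    (hψ : ∀ c, HasParity (p c) (ψ c)) {c₁ c₂ : C} (hne : c₁ ≠ c₂) (i j : κ) :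
    star (P.prodFamily ψ) ⬝ᵥ ((annihilation (P.emb c₁ i) * annihilation (P.emb c₂ j)) *ᵥ P.prodFamily ψ) = 0 := by
  rw [← mulVec_mulVec, ← jwEmbed_annihilation, ← jwEmbed_annihilation]
  exact star_prodFamily_dotProduct_jwEmbed_jwEmbed_eq_zero P hψ hne (Partition.isParityReversing_annihilation i)
    (Partition.isParityReversing_annihilation j)

/-- `c†_{emb c₁ i} c†_{emb c₂ j}` (adjoint inter-cluster pair, `c₁ ≠ c₂`) has zero expectation.
[cite: BratteliRobinsonII1997, §5.2.2 eq. (5.2.13)] -/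
theorem star_prodFamily_dotProduct_creation_creation_eq_zero [DecidableEq C] {ψ : C → Fock κ} {p : C → ℕ}
    (hψ : ∀ c, HasParity (p c) (ψ c)) {c₁ c₂ : C} (hne : c₁ ≠ c₂) (i j : κ) :
    star (P.prodFamily ψ) ⬝ᵥ ((creation (P.emb c₁ i) * creation (P.emb c₂ j)) *ᵥ P.prodFamily ψ) = 0 := by
  rw [← mulVec_mulVec, ← jwEmbed_creation, ← jwEmbed_creation]
  exact star_prodFamily_dotProduct_jwEmbed_jwEmbed_eq_zero P hψ hne (Partition.isParityReversing_creation i)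
    (Partition.isParityReversing_creation j)


end ClusterParity

/-! ## §2 No wrap-around inside a block -/

namespace TorusRectBlock

variable {L Kx Ky a b : ℕ} (hLa : L = Kx * a) (hLb : L = Ky * b)

/-- In `ZMod L`: `Y ≡ X + t` with `|X + t − Y| < L` forces `Y = X + t` (no wrap-around). [folklore] -/
theorem natCast_eq_natCast_add_intCast_iff {X Y : ℕ} {t : ℤ} (h : |(X : ℤ) + t - Y| < L) :
    ((Y : ℕ) : ZMod L) = ((X : ℕ) : ZMod L) + ((t : ℤ) : ZMod L) ↔ (Y : ℤ) = X + t := by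
  have e1 : ((X : ℕ) : ZMod L) + ((t : ℤ) : ZMod L) = (((X : ℤ) + t : ℤ) : ZMod L) := by push_cast; ring
  have e2 : ((Y : ℕ) : ZMod L) = ((Y : ℤ) : ZMod L) := by push_cast; ring
  rw [e1, e2, ZMod.intCast_eq_intCast_iff_dvd_sub]
  constructor
  · intro hd
    have h0 := Int.eq_zero_of_abs_lt_dvd hd h
    linarith
  · intro heq
    rw [heq, sub_self]
    exact dvd_zero _

/-- **The torus step relation inside one block is the box step relation** (`a, b < L`): for a step
`e` with `|eᵢ| ≤ 1`, `blockSite R q = blockSite R p + e` on the torus `(ℤ/Lℤ)²` iff `q = p + e` in `ℤ²`.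
[cite: Ruelle1969, §3.3] -/
theorem toTorusSite_blockSite_eq_add_proj_iff (haL : a < L) (hbL : b < L) (R : Fin Kx ×ₗ Fin Ky)
    (p q : Fin a ×ₗ Fin b) {e : Site 2} (he : ∀ i, |e i| ≤ 1) :
    FermionTorus.toTorusSite (blockSite hLa hLb R q) =
        FermionTorus.toTorusSite (blockSite hLa hLb R p) + Torus.proj L e ↔
      ((((ofLex q).1 : ℕ) : ℤ) = (((ofLex p).1 : ℕ) : ℤ) + e 0 ∧
        (((ofLex q).2 : ℕ) : ℤ) = (((ofLex p).2 : ℕ) : ℤ) + e 1) := by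
  -- the two coordinate bounds `|X_p + e − X_q| < L`
  have hb0 : |(((ofLex (blockSite hLa hLb R p)) 0 : ℕ) : ℤ) + e 0 -
      (((ofLex (blockSite hLa hLb R q)) 0 : ℕ) : ℤ)| < L := by
    rw [blockSite_apply_zero, blockSite_apply_zero]
    have h1 := abs_le.1 (he 0)
    have hp := (ofLex p).1.isLt
    have hq := (ofLex q).1.isLt
    push_cast
    rw [show ((((ofLex R).1 : ℕ) : ℤ) * a + (((ofLex p).1 : ℕ) : ℤ) + e 0 -
        ((((ofLex R).1 : ℕ) : ℤ) * a + (((ofLex q).1 : ℕ) : ℤ))) =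
        (((ofLex p).1 : ℕ) : ℤ) + e 0 - (((ofLex q).1 : ℕ) : ℤ) by ring]
    rw [abs_lt]
    constructor <;> omega
  have hb1 : |(((ofLex (blockSite hLa hLb R p)) 1 : ℕ) : ℤ) + e 1 -
      (((ofLex (blockSite hLa hLb R q)) 1 : ℕ) : ℤ)| < L := by
    rw [blockSite_apply_one, blockSite_apply_one]
    have h1 := abs_le.1 (he 1)
    have hp := (ofLex p).2.isLt
    have hq := (ofLex q).2.isLt
    push_cast
    rw [show ((((ofLex R).2 : ℕ) : ℤ) * b + (((ofLex p).2 : ℕ) : ℤ) + e 1 -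
        ((((ofLex R).2 : ℕ) : ℤ) * b + (((ofLex q).2 : ℕ) : ℤ))) =
        (((ofLex p).2 : ℕ) : ℤ) + e 1 - (((ofLex q).2 : ℕ) : ℤ) by ring]
    rw [abs_lt]
    constructor <;> omega
  -- coordinatewise
  have key : ∀ i : Fin 2,
      |(((ofLex (blockSite hLa hLb R p)) i : ℕ) : ℤ) + e i - (((ofLex (blockSite hLa hLb R q)) i : ℕ) : ℤ)| < L →
      (FermionTorus.toTorusSite (blockSite hLa hLb R q) i =
          (FermionTorus.toTorusSite (blockSite hLa hLb R p) + Torus.proj L e) i ↔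
        (((ofLex (blockSite hLa hLb R q)) i : ℕ) : ℤ) = (((ofLex (blockSite hLa hLb R p)) i : ℕ) : ℤ) + e i) := by
    intro i hi
    rw [Pi.add_apply, FermionTorus.toTorusSite_apply, FermionTorus.toTorusSite_apply]
    exact natCast_eq_natCast_add_intCast_iff hi
  have k0 := key 0 hb0
  have k1 := key 1 hb1
  rw [blockSite_apply_zero, blockSite_apply_zero] at k0
  rw [blockSite_apply_one, blockSite_apply_one] at k1
  push_cast at k0 k1
  constructor
  · intro h
    have h0 := k0.1 (congrFun h 0)
    have h1 := k1.1 (congrFun h 1)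
    constructor
    · linarith
    · linarith
  · rintro ⟨h0, h1⟩
    funext i
    rcases Fin.eq_zero_or_eq_succ i with hi | ⟨k, hk⟩
    · subst hi
      exact k0.2 (by linarith)
    · have hk0 : k = 0 := Fin.eq_zero k
      subst hk0
      have hi1 : i = 1 := by rw [hk]; rfl
      subst hi1
      exact k1.2 (by linarith)

/-- The unit steps of `ℤ²` project to the unit steps of `(ℤ/Lℤ)²`. [folklore] -/
theorem proj_single_one (i : Fin 2) : Torus.proj L (Pi.single i (1 : ℤ)) = Pi.single i (1 : ZMod L) := by
  funext j
  change (((Pi.single i (1 : ℤ) : Site 2) j : ℤ) : ZMod L) = (Pi.single i (1 : ZMod L) : TorusSite 2 L) j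
  by_cases h : j = i
  · subst h
    simp
  · simp [Pi.single_eq_of_ne h]

/-- The entries of a unit step are bounded by one. [folklore] -/
theorem abs_single_one_apply_le (i j : Fin 2) : |(Pi.single i (1 : ℤ) : Site 2) j| ≤ 1 := by
  by_cases h : j = i
  · subst h
    simp
  · simp [Pi.single_eq_of_ne h]

/-- `toTorusSite` is injective (`L ≠ 0`). [folklore] -/
theorem toTorusSite_injective [NeZero L] : Function.Injective (FermionTorus.toTorusSite (d := 2) (L := L)) := by
  intro x y h
  rw [← FermionTorus.ofTorusSite_toTorusSite x, h, FermionTorus.ofTorusSite_toTorusSite]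

/-- **Torus adjacency of two sites of one block is open-box adjacency** (`a, b < L`): no bond of the
torus joins two sites of the same block around the torus. [cite: Ruelle1969, §3.3] -/
theorem fermionTorusGraph_adj_blockSite_iff (haL : a < L) (hbL : b < L) (R : Fin Kx ×ₗ Fin Ky)
    (p q : Fin a ×ₗ Fin b) :
    (fermionTorusGraph 2 L).Adj (blockSite hLa hLb R p) (blockSite hLa hLb R q) ↔ (rectBoxGraph a b).Adj p q := by
  have step : ∀ (p q : Fin a ×ₗ Fin b) (i : Fin 2),
      FermionTorus.toTorusSite (blockSite hLa hLb R q) =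
          FermionTorus.toTorusSite (blockSite hLa hLb R p) + Pi.single i 1 ↔
        ((((ofLex q).1 : ℕ) : ℤ) = (((ofLex p).1 : ℕ) : ℤ) + (Pi.single i (1 : ℤ) : Site 2) 0 ∧
          (((ofLex q).2 : ℕ) : ℤ) = (((ofLex p).2 : ℕ) : ℤ) + (Pi.single i (1 : ℤ) : Site 2) 1) := by
    intro p q i
    rw [← proj_single_one, toTorusSite_blockSite_eq_add_proj_iff hLa hLb haL hbL R p q (abs_single_one_apply_le i)]
  have s00 : (Pi.single (0 : Fin 2) (1 : ℤ) : Site 2) 0 = 1 := by simp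
  have s01 : (Pi.single (0 : Fin 2) (1 : ℤ) : Site 2) 1 = 0 := by simp
  have s10 : (Pi.single (1 : Fin 2) (1 : ℤ) : Site 2) 0 = 0 := by simp
  have s11 : (Pi.single (1 : Fin 2) (1 : ℤ) : Site 2) 1 = 1 := by simp
  -- a unit step never fixes a site (integer form: `X = X + 1` is absurd)
  have hne : ∀ (p q : Fin a ×ₗ Fin b) (i : Fin 2),
      FermionTorus.toTorusSite (blockSite hLa hLb R q) =
        FermionTorus.toTorusSite (blockSite hLa hLb R p) + Pi.single i 1 →
      FermionTorus.toTorusSite (blockSite hLa hLb R p) ≠ FermionTorus.toTorusSite (blockSite hLa hLb R q) := by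
    intro p q i hi heq
    rw [heq] at hi
    obtain ⟨h0, h1⟩ := (step q q i).1 hi
    rcases Fin.eq_zero_or_eq_succ i with hi0 | ⟨k, hk⟩
    · subst hi0
      rw [s00] at h0
      linarith
    · have hk0 : k = 0 := Fin.eq_zero k
      subst hk0
      have hi1 : i = 1 := by rw [hk]; rfl
      subst hi1
      rw [s11] at h1
      linarith
  -- integer form of the torus adjacency
  have htorus : (fermionTorusGraph 2 L).Adj (blockSite hLa hLb R p) (blockSite hLa hLb R q) ↔
      (((((ofLex q).1 : ℕ) : ℤ) = (((ofLex p).1 : ℕ) : ℤ) + 1 ∧ (((ofLex q).2 : ℕ) : ℤ) = (((ofLex p).2 : ℕ) : ℤ)) ∨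
       ((((ofLex q).1 : ℕ) : ℤ) = (((ofLex p).1 : ℕ) : ℤ) ∧ (((ofLex q).2 : ℕ) : ℤ) = (((ofLex p).2 : ℕ) : ℤ) + 1) ∨
       ((((ofLex p).1 : ℕ) : ℤ) = (((ofLex q).1 : ℕ) : ℤ) + 1 ∧ (((ofLex p).2 : ℕ) : ℤ) = (((ofLex q).2 : ℕ) : ℤ)) ∨
       ((((ofLex p).1 : ℕ) : ℤ) = (((ofLex q).1 : ℕ) : ℤ) ∧ (((ofLex p).2 : ℕ) : ℤ) = (((ofLex q).2 : ℕ) : ℤ) + 1)) := by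
    rw [fermionTorusGraph_adj, torusGraph_adj_iff]
    constructor
    · rintro ⟨-, ⟨i, hi⟩ | ⟨i, hi⟩⟩
      · obtain ⟨h0, h1⟩ := (step p q i).1 hi
        rcases Fin.eq_zero_or_eq_succ i with hi0 | ⟨k, hk⟩
        · subst hi0
          rw [s00] at h0
          rw [s01] at h1
          exact Or.inl ⟨h0, by linarith⟩
        · have hk0 : k = 0 := Fin.eq_zero k
          subst hk0
          have hi1 : i = 1 := by rw [hk]; rfl
          subst hi1
          rw [s10] at h0
          rw [s11] at h1
          exact Or.inr (Or.inl ⟨by linarith, h1⟩)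
      · obtain ⟨h0, h1⟩ := (step q p i).1 hi
        rcases Fin.eq_zero_or_eq_succ i with hi0 | ⟨k, hk⟩
        · subst hi0
          rw [s00] at h0
          rw [s01] at h1
          exact Or.inr (Or.inr (Or.inl ⟨h0, by linarith⟩))
        · have hk0 : k = 0 := Fin.eq_zero k
          subst hk0
          have hi1 : i = 1 := by rw [hk]; rfl
          subst hi1
          rw [s10] at h0
          rw [s11] at h1
          exact Or.inr (Or.inr (Or.inr ⟨by linarith, h1⟩))
    · intro h
      rcases h with ⟨h0, h1⟩ | ⟨h0, h1⟩ | ⟨h0, h1⟩ | ⟨h0, h1⟩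
      · have hs := (step p q 0).2 ⟨by rw [s00]; exact h0, by rw [s01]; linarith⟩
        exact ⟨hne p q 0 hs, Or.inl ⟨0, hs⟩⟩
      · have hs := (step p q 1).2 ⟨by rw [s10]; linarith, by rw [s11]; exact h1⟩
        exact ⟨hne p q 1 hs, Or.inl ⟨1, hs⟩⟩
      · have hs := (step q p 0).2 ⟨by rw [s00]; exact h0, by rw [s01]; linarith⟩
        exact ⟨(hne q p 0 hs).symm, Or.inr ⟨0, hs⟩⟩
      · have hs := (step q p 1).2 ⟨by rw [s10]; linarith, by rw [s11]; exact h1⟩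
        exact ⟨(hne q p 1 hs).symm, Or.inr ⟨1, hs⟩⟩
  rw [htorus]
  -- the box adjacency in integer form
  change _ ↔ (((ofLex p).2 = (ofLex q).2 ∧ lineAdj ((ofLex p).1 : ℕ) ((ofLex q).1 : ℕ)) ∨
    ((ofLex p).1 = (ofLex q).1 ∧ lineAdj ((ofLex p).2 : ℕ) ((ofLex q).2 : ℕ)))
  simp only [lineAdj, Fin.ext_iff]
  omega

end TorusRectBlock

end Summit.Ventures.CertifiedManyBodySolver

end
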